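import Mathlib
import Summits.KontsevichZagierPeriods.Zeta5Search.LaiSaving
import HarnessLib

/-!
# ζ(5) search — Lai's exponent table `φ̃(n/p)` and the closed-form saving factor `Φ̃_n`
# (fam-indep, κ₃ ladder: the L1 / Φ̃ input, step 6 = [Lai2024BallRivoal, (4.5)–(4.6), Lemma 4.4])

HONEST FRAMING: systematic search; no irrationality claim unless certified.

OUR work (Summit side; cell `pub-zeta5`, family `indep`, planner seat gen 4, STAGED for the lane). Continues
`LaiBricks.lean` → `LaiBrickCoefficients.lean` → `LaiDenominators.lean` → `LaiSaving.lean`. That file proved the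
skeleton fields `isInt` / `dvd3` with `Φ := Φ_e` for ANY admissible exponent table `e`. Here the table is no longer a
parameter: `laiPhiDiv ≥ 0` identically (`laiPhiDiv_nonneg`: the telescoped brick exponent is a sum of `J + 2` floor
super-additivity defects `⌊(a+b)/p⌋ − ⌊a/p⌋ − ⌊b/p⌋ ≥ 0` and two defects `⌊rn/p⌋ − r⌊n/p⌋ ≥ 0`), hence the window minimum
`laiPhiMin n p := min_{dmin·n ≤ k ≤ (M−dmin)n} φ̃(n/p, k/p)` (as a natural number) is an admissible table
(`laiPhiMin_admissible`), and `laiPhiTilde := laiPhiGen J M dmin laiPhiMin` is a CLOSED-FORM saving factor for which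
`isInt` / `dvd3` hold with no hypothesis beyond the parameter side conditions (`laiCoef_isInt_phiTilde`,
`laiCoef_dvd3_phiTilde`). Because `φ̃(n/p, ·)` is `1`-periodic in `y` with all breakpoints on the grid `(1/p)ℤ`, and the
window has length `(M − 2·dmin)n ≥ p`, this minimum equals Lai's `φ̃(n/p) = min_{y ∈ ℝ} φ̃(n/p, y)` ([Lai2024BallRivoal,
(4.6), §13]) — an identification needed only for the RATE `ϖ̃ = lim (1/n) log Φ̃_n` (the successor's `savingRate` field,
together with the decay / growth rates and the numerics), not for the arithmetic, which is COMPLETE with this file: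
in the κ₃ skeleton `LaiBoxInputs J r M δ m` one may now put `coef := laiCoef`, `C := laiC`, `Dm j := max (M−2·dmin) (M−δ_j)`,
`Φ := laiPhiTilde`, and discharge `hasSum`, `isInt`, `dvd3` by `laiCoef_hasSum`, `laiCoef_isInt_phiTilde`,
`laiCoef_dvd3_phiTilde`.

Everything here is PROVED (0 sorries) for arbitrary parameters; nothing is a named fact; no rate or irrationality
statement. Kernel status: checked on the farm as the tail of ONE file `LaiBricks ++ LaiBrickCoefficients ++
LaiDenominators ++ LaiSaving ++ this file` (`lean check --json` rc 0 / 0 errors / 0 warnings / 0 sorries, also with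
`--no-snap`); as a separate module it elaborates verbatim once `Zeta5Search/LaiSaving.lean` is in the tree.

Section `Kappa3` then INSTANTIATES the arithmetic at the fam-indep κ₃-ladder CANDIDATE point `J = 74`, `r = 2180`, `M = 444`,
block profile `δ74` (sorted, `δ_min = δ₂ = 5`), `m = 36`: side conditions by `decide`, the coefficient tables `kappa3Coef`
(from `lai_pf_exists_all`), and `kappa3_hasSum`, `kappa3_isInt`, `kappa3_dvd3` (divisor scale `c = 439`), `kappa3_Φ_pos`,
`sum_Dm74` (`S = 32178`) — i.e. the fields `coef, hasSum, C, Dm, Φ, Φ_pos, c, isInt, dvd3` of `LaiBoxInputs 74 2180 444 δ74 36`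
(after `simp only [normaliser, blockDenom]`). MANUSCRIPT-LEVEL CANDIDATE, NOT certified: the remaining fields (rates
`α, ϖ, β` with `decay, savingRate, growth`, and the numerics `decay_pos, growth_pos, margin`) are OPEN; nothing here is a
rate, margin or dimension statement.

References: [Lai2024BallRivoal] L. Lai, arXiv:2407.14236, §4 (4.5)–(4.6), Lemma 4.4, §13 (proof of Claim 1.4);
[Zudilin2004] W. Zudilin, J. Théor. Nombres Bordeaux 16 (2004), §7 Lemmas 17–18 (the floor-bracket form of the exponents).
-/

noncomputable section

open Finset Filter Literature.NumberTheory.Transcendental Literature.Analysis.Calculus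
open scoped Nat

namespace Summit.KontsevichZagierPeriods.Zeta5Search

section PhiTable

/-! ## Lai's exponent table `φ̃(n/p) = min_k φ̃(n/p, k/p)` — definition, admissibility, hence a CLOSED-FORM `Φ̃`

`laiPhiDiv ≥ 0` everywhere (it is a sum of `2r + J + 2` floor super-additivity defects), so the window minimum
`laiPhiMin` (as a natural number) is an ADMISSIBLE exponent table, and `laiPhiTilde := laiPhiGen … (laiPhiMin …)` is a
closed-form saving factor for which `isInt`/`dvd3` hold with no hypothesis beyond the parameter side conditions
(`laiCoef_isInt_phiTilde`, `laiCoef_dvd3_phiTilde`). Since `φ̃(x, ·)` is `1`-periodic with breakpoints on the grid `(1/p)ℤ`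
when `x = n/p`, and the window has length `(M−2·dmin)n ≥ p`, this minimum IS Lai's `φ̃(n/p) = inf_{y∈ℝ} φ̃(n/p, y)`
([Lai2024BallRivoal, (4.6), §13]); that identification is only needed for the RATE `ϖ̃`, not here. -/

/-- Floor super-additivity for `Int` division by a positive integer: `a/p + b/p ≤ (a+b)/p`. [folklore] -/
theorem int_ediv_add_ediv_le {p : ℤ} (hp : 0 < p) (a b : ℤ) : a / p + b / p ≤ (a + b) / p := by
  refine Int.le_ediv_of_mul_le hp ?_
  have ha := Int.ediv_mul_le a hp.ne'
  have hb := Int.ediv_mul_le b hp.ne'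
  linarith [add_mul (a / p) (b / p) p]

/-- `r·⌊n/p⌋ ≤ ⌊rn/p⌋`. [folklore] -/
theorem int_mul_ediv_le {p : ℤ} (hp : 0 < p) (r n : ℤ) (hr : 0 ≤ r) : r * (n / p) ≤ r * n / p := by
  refine Int.le_ediv_of_mul_le hp ?_
  have := Int.ediv_mul_le n hp.ne'
  nlinarith

/-- **`φ̃(n/p, k/p) ≥ 0`** for every `k` and every `p > 0`. [this file] -/
theorem laiPhiDiv_nonneg (J r M n : ℕ) (δ : Fin J → ℕ) (k : ℕ) {p : ℕ} (hp : 0 < p) :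
    0 ≤ laiPhiDiv J r M n δ k p := by
  have hp' : (0 : ℤ) < (p : ℤ) := by exact_mod_cast hp
  unfold laiPhiDiv
  -- the `J` block terms
  have hJ : 0 ≤ ∑ j : Fin J, ((((M - 2 * δ j) * n : ℕ) : ℤ) / p - ((k : ℤ) - ((δ j * n : ℕ) : ℤ)) / p
      - ((((M - δ j) * n : ℕ) : ℤ) - k) / p) := by
    refine sum_nonneg fun j _ => ?_
    by_cases hδ : 2 * δ j ≤ M
    · have e : (((M - 2 * δ j) * n : ℕ) : ℤ) = ((k : ℤ) - ((δ j * n : ℕ) : ℤ)) + ((((M - δ j) * n : ℕ) : ℤ) - k) := by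
        have h1 : ((M - 2 * δ j : ℕ) : ℤ) = M - 2 * δ j := by push_cast [Nat.cast_sub hδ]; ring
        have h2 : ((M - δ j : ℕ) : ℤ) = M - δ j := by push_cast [Nat.cast_sub (by omega : δ j ≤ M)]; ring
        push_cast [h1, h2]; ring
      rw [e]
      linarith [int_ediv_add_ediv_le hp' ((k : ℤ) - ((δ j * n : ℕ) : ℤ)) ((((M - δ j) * n : ℕ) : ℤ) - k)]
    · -- degenerate block `2δ_j > M`: `(M − 2δ_j) = 0` and `M − δ_j ≤ δ_j`
      have h0 : ((M - 2 * δ j) * n : ℕ) = 0 := by rw [Nat.sub_eq_zero_of_le (by omega), zero_mul]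
      rw [h0]
      have hle : (((M - δ j) * n : ℕ) : ℤ) ≤ ((δ j * n : ℕ) : ℤ) := by
        exact_mod_cast Nat.mul_le_mul_right n (by omega : M - δ j ≤ δ j)
      have := int_ediv_add_ediv_le hp' ((k : ℤ) - ((δ j * n : ℕ) : ℤ)) ((((M - δ j) * n : ℕ) : ℤ) - k)
      have hneg : ((k : ℤ) - ((δ j * n : ℕ) : ℤ) + ((((M - δ j) * n : ℕ) : ℤ) - k)) / p ≤ 0 := by
        have hnum : (k : ℤ) - ((δ j * n : ℕ) : ℤ) + ((((M - δ j) * n : ℕ) : ℤ) - k) ≤ 0 := by linarith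
        have := Int.ediv_le_ediv hp' hnum   -- ?  (a ≤ b → a / p ≤ b / p)
        simpa using this
      simp only [Nat.cast_zero, Int.zero_ediv]  -- hmm `((0:ℕ):ℤ) / p = 0`
      linarith
  -- the two `r`-groups
  have h1 : (k : ℤ) / p + ((r : ℤ) * n) / p ≤ ((k : ℤ) + r * n) / p := int_ediv_add_ediv_le hp' _ _
  have h2 : ((M : ℤ) * n - k) / p + ((r : ℤ) * n) / p ≤ (((r : ℤ) + M) * n - k) / p := by
    have := int_ediv_add_ediv_le hp' ((M : ℤ) * n - k) ((r : ℤ) * n)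
    have e : (M : ℤ) * n - k + r * n = ((r : ℤ) + M) * n - k := by ring
    rwa [e] at this
  have h3 : (r : ℤ) * ((n : ℤ) / p) ≤ (r : ℤ) * n / p := int_mul_ediv_le hp' r n (by positivity)
  linarith

/-- Lai's exponent table: `φ̃(n/p) := min_{dmin·n ≤ k ≤ (M−dmin)n} φ̃(n/p, k/p)` as a natural number (`0` on an empty
window). [cite: Lai2024BallRivoal, (4.5)–(4.6)] -/
def laiPhiMin (J r M : ℕ) (δ : Fin J → ℕ) (dmin n p : ℕ) : ℕ :=
  if h : (Icc (dmin * n) ((M - dmin) * n)).Nonempty then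
    (((Icc (dmin * n) ((M - dmin) * n)).image fun k => laiPhiDiv J r M n δ k p).min' (h.image _)).toNat
  else 0

/-- **The table `laiPhiMin` is admissible.** [this file] -/
theorem laiPhiMin_admissible (J r M : ℕ) (δ : Fin J → ℕ) (dmin : ℕ) :
    LaiExpAdmissible J r M δ dmin (laiPhiMin J r M δ dmin) := by
  intro n p k hp hJp hp1 hp2 hk1 hk2
  have hk : k ∈ Icc (dmin * n) ((M - dmin) * n) := mem_Icc.2 ⟨hk1, hk2⟩
  have hne : (Icc (dmin * n) ((M - dmin) * n)).Nonempty := ⟨k, hk⟩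
  unfold laiPhiMin
  rw [dif_pos hne]
  set m := ((Icc (dmin * n) ((M - dmin) * n)).image fun k => laiPhiDiv J r M n δ k p).min' (hne.image _) with hm
  have hmle : m ≤ laiPhiDiv J r M n δ k p := Finset.min'_le _ _ (mem_image_of_mem _ hk)
  by_cases h0 : 0 ≤ m
  · rw [Int.toNat_of_nonneg h0]; exact hmle
  · rw [Int.toNat_eq_zero.2 (by omega)]
    simpa using laiPhiDiv_nonneg J r M n δ k hp.pos

/-- Lai's saving factor `Φ̃_n` in closed form (for the primes `J ≤ p ≤ (M−2·dmin)n`, `Mn < p²`).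
[cite: Lai2024BallRivoal, (4.5), §13] -/
def laiPhiTilde (J r M : ℕ) (δ : Fin J → ℕ) (dmin n : ℕ) : ℕ :=
  laiPhiGen J M dmin (laiPhiMin J r M δ dmin) n

/-- **`isInt` with Lai's `Φ̃`** (no hypothesis on a table). [cite: Lai2024BallRivoal, Lemma 4.4] -/
theorem laiCoef_isInt_phiTilde (J r M : ℕ) (δ : Fin J → ℕ) (hδ : ∀ j, 2 * δ j ≤ M) (hM : 0 < M)
    (hmono : Monotone δ) (c : ℕ → ℕ → ℕ → ℚ)
    (hc : ∀ n : ℕ, ∀ t : ℚ, (∀ p : ℕ, p ≤ M * n → t + p + 1 ≠ 0) →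
      BallRivoal.pfEval (M * n) J (c n) t =
        ((laiPoly J r M n δ).comp (Polynomial.X + Polynomial.C 1)).eval t /
          BallRivoal.poch (t + 1) (M * n + 1) ^ J)
    (dmin : ℕ) (hmin : ∀ j, dmin ≤ δ j) (h2 : 2 * dmin < M) (n s : ℕ) :
    ∃ z : ℤ, (z : ℚ) = laiC J r M n δ * ((∏ j, Nat.lcmUpto (max (M - 2 * dmin) (M - δ j) * n) : ℕ) : ℚ)
      / (laiPhiTilde J r M δ dmin n : ℚ) * laiCoef J M c n s :=
  laiCoef_isInt_phi J r M δ hδ hM hmono c hc dmin hmin h2 _ (laiPhiMin_admissible J r M δ dmin) n s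

/-- **`dvd3` with Lai's `Φ̃`**. [cite: Lai2024BallRivoal, §13 (proof of Claim 1.4)] -/
theorem laiCoef_dvd3_phiTilde (J r M : ℕ) (δ : Fin J → ℕ) (hδ : ∀ j, 2 * δ j ≤ M) (hM : 0 < M)
    (hmono : Monotone δ) (hJ3 : 3 ≤ J) (c : ℕ → ℕ → ℕ → ℚ)
    (hc : ∀ n : ℕ, ∀ t : ℚ, (∀ p : ℕ, p ≤ M * n → t + p + 1 ≠ 0) →
      BallRivoal.pfEval (M * n) J (c n) t =
        ((laiPoly J r M n δ).comp (Polynomial.X + Polynomial.C 1)).eval t /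
          BallRivoal.poch (t + 1) (M * n + 1) ^ J)
    (dmin : ℕ) (hmin : ∀ j, dmin ≤ δ j) (h2 : 2 * dmin < M) (n s : ℕ) (hs : 3 ≤ s) :
    ∃ z : ℤ, (z : ℚ) * ((Nat.lcmUpto ((M - δ ⟨2, by omega⟩) * n) ^ 3 : ℕ) : ℚ) =
      laiC J r M n δ * ((∏ j, Nat.lcmUpto (max (M - 2 * dmin) (M - δ j) * n) : ℕ) : ℚ)
        / (laiPhiTilde J r M δ dmin n : ℚ) * laiCoef J M c n s :=
  laiCoef_dvd3_phi J r M δ hδ hM hmono hJ3 c hc dmin hmin h2 _ (laiPhiMin_admissible J r M δ dmin) n s hs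

end PhiTable

section Kappa3

open Polynomial

/-! ## The κ₃-ladder candidate `J = 74` (`r = 2180`, `M = 444`, `m = 36`): the ARITHMETIC inputs, instantiated

MANUSCRIPT-LEVEL CANDIDATE, NOT certified: the table `δ74` below is the fam-indep candidate point of the block box
(families/indep/FAMILY.md §5.13, KAPPA3.md §7); this section only INSTANTIATES the parametric arithmetic theorems of the
chain at that point (side conditions by `decide`), it makes no rate, margin or dimension statement. -/

/-- The candidate block profile `δ74` (sorted; `δ_min = 5`, `δ₂ = 5`, `max = 119`; `Σ_j δ_j = 3393`). [this file] -/
def δ74 : Fin 74 → ℕ :=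
  ![5, 5, 5, 5, 5, 5, 5, 5, 5, 6, 6, 7, 7, 8, 9, 10, 11, 12, 13, 14, 15, 16, 17, 18, 19, 20, 21,
    22, 23, 24, 26, 28, 30, 32, 34, 36, 38, 40, 42, 44, 46, 48, 50, 52, 54, 56, 58, 60, 62, 64,
    66, 68, 70, 72, 74, 76, 78, 80, 82, 84, 86, 88, 90, 92, 94, 96, 98, 100, 102, 104, 106, 110,
    115, 119]

/-- `δ74` is sorted. [this file] -/
theorem δ74_monotone : Monotone δ74 := Fin.monotone_iff_le_succ.2 (by decide)

/-- `2δ_j ≤ M = 444`. [this file] -/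
theorem two_mul_δ74_le (j : Fin 74) : 2 * δ74 j ≤ 444 := by revert j; decide

/-- `δ_min = 5 ≤ δ_j`. [this file] -/
theorem five_le_δ74 (j : Fin 74) : 5 ≤ δ74 j := by revert j; decide

/-- `δ_j ≤ 119`. [this file] -/
theorem δ74_le (j : Fin 74) : δ74 j ≤ 119 := by revert j; decide

/-- `δ₂ = 5` (so the divisor scale is `c = M − δ₂ = 439`). [this file] -/
theorem δ74_two : δ74 ⟨2, by norm_num⟩ = 5 := by decide

/-- `Σ_j δ_j = 3393`. [this file] -/
theorem sum_δ74 : ∑ j, δ74 j = 3393 := by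
  set_option maxRecDepth 10000 in decide

/-- The denominator multipliers sum to `S = Σ_j max(434, 444 − δ_j) = 32178`. [this file] -/
theorem sum_Dm74 : ∑ j, max (444 - 2 * 5) (444 - δ74 j) = 32178 := by
  set_option maxRecDepth 10000 in decide

/-- The degree condition of the partial-fraction decomposition at `J = 74`, `r = 2180`, `M = 444`. [this file] -/
theorem hdeg74 (n : ℕ) : 1 + 2 * (2180 * n) + (∑ j, 2 * (δ74 j * n)) + 2 ≤ 74 * (444 * n + 1) := by
  have h : ∑ j, 2 * (δ74 j * n) ≤ ∑ _j : Fin 74, 2 * (119 * n) :=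
    sum_le_sum fun j _ => Nat.mul_le_mul_left _ (Nat.mul_le_mul_right _ (δ74_le j))
  rw [sum_const, card_univ, Fintype.card_fin, smul_eq_mul] at h
  omega

/-- Existence of the coefficient tables `c n` of Lai's `R̃_n(t−1)` at the candidate point. [this file] -/
theorem kappa3_coef_exists : ∃ c : ℕ → ℕ → ℕ → ℚ, ∀ n : ℕ, ∀ t : ℚ, (∀ p : ℕ, p ≤ 444 * n → t + p + 1 ≠ 0) →
    BallRivoal.pfEval (444 * n) 74 (c n) t =
      ((laiPoly 74 2180 444 n δ74).comp (X + C 1)).eval t / BallRivoal.poch (t + 1) (444 * n + 1) ^ 74 :=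
  lai_pf_exists_all 74 2180 444 δ74 (by norm_num) hdeg74

/-- A choice of coefficient tables at the candidate point. [this file] -/
def kappa3Coef : ℕ → ℕ → ℕ → ℚ := kappa3_coef_exists.choose

/-- The defining property of `kappa3Coef`. [this file] -/
theorem kappa3Coef_spec : ∀ n : ℕ, ∀ t : ℚ, (∀ p : ℕ, p ≤ 444 * n → t + p + 1 ≠ 0) →
    BallRivoal.pfEval (444 * n) 74 (kappa3Coef n) t =
      ((laiPoly 74 2180 444 n δ74).comp (X + C 1)).eval t / BallRivoal.poch (t + 1) (444 * n + 1) ^ 74 :=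
  kappa3_coef_exists.choose_spec

/-- **`hasSum` at the candidate point**: `Σ_k R̃_n(k+1)/C_n = laiCoef n 0 + Σ_{odd 3≤s≤74} laiCoef n s · ζ(s)`. [this file] -/
theorem kappa3_hasSum (n : ℕ) :
    HasSum (fun k : ℕ => ((laiCore 74 2180 444 n δ74 ((k : ℚ) + 1) : ℚ) : ℝ))
      (((laiCoef 74 444 kappa3Coef n 0 : ℚ) : ℝ) +
        ∑ s ∈ (Icc 3 74).filter Odd, ((laiCoef 74 444 kappa3Coef n s : ℚ) : ℝ) * zetaValue s) :=
  laiCoef_hasSum 74 2180 444 δ74 (by decide) (by norm_num) two_mul_δ74_le hdeg74 kappa3Coef kappa3Coef_spec n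

/-- **`isInt` at the candidate point** with `C := laiC`, `Dm_j := max(434, 444 − δ_j)`, `Φ := Φ̃ = laiPhiTilde … 5`. [this file] -/
theorem kappa3_isInt (n s : ℕ) : ∃ z : ℤ, (z : ℚ) =
    laiC 74 2180 444 n δ74 * ((∏ j, Nat.lcmUpto (max (444 - 2 * 5) (444 - δ74 j) * n) : ℕ) : ℚ)
      / (laiPhiTilde 74 2180 444 δ74 5 n : ℚ) * laiCoef 74 444 kappa3Coef n s :=
  laiCoef_isInt_phiTilde 74 2180 444 δ74 two_mul_δ74_le (by norm_num) δ74_monotone kappa3Coef kappa3Coef_spec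
    5 five_le_δ74 (by norm_num) n s

/-- **`dvd3` at the candidate point** with divisor scale `c = 439`. [this file] -/
theorem kappa3_dvd3 (n s : ℕ) (hs : 3 ≤ s) : ∃ z : ℤ, (z : ℚ) * ((Nat.lcmUpto (439 * n) ^ 3 : ℕ) : ℚ) =
    laiC 74 2180 444 n δ74 * ((∏ j, Nat.lcmUpto (max (444 - 2 * 5) (444 - δ74 j) * n) : ℕ) : ℚ)
      / (laiPhiTilde 74 2180 444 δ74 5 n : ℚ) * laiCoef 74 444 kappa3Coef n s := by
  have h := laiCoef_dvd3_phiTilde 74 2180 444 δ74 two_mul_δ74_le (by norm_num) δ74_monotone (by norm_num)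
    kappa3Coef kappa3Coef_spec 5 five_le_δ74 (by norm_num) n s hs
  have e : 444 - δ74 ⟨2, by norm_num⟩ = 439 := by rw [δ74_two]
  rwa [e] at h

/-- The saving factor at the candidate point is positive (skeleton field `Φ_pos`). [this file] -/
theorem kappa3_Φ_pos (n : ℕ) : 0 < laiPhiTilde 74 2180 444 δ74 5 n := laiPhiGen_pos _ _ _ _ _

end Kappa3

end Summit.KontsevichZagierPeriods.Zeta5Search

end
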